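import Summits.RiemannHypothesis.RiemannHypothesis.Theses.UniversalFactor
import Summits.RiemannHypothesis.RiemannHypothesis.Theorems.UniversalFactorLaguerreCriterion
import Summits.RiemannHypothesis.RiemannHypothesis.Theorems.UniversalFactorMediumLowWindowA
import Summits.RiemannHypothesis.RiemannHypothesis.Theorems.UniversalFactorMediumLowWindowB
import Summits.RiemannHypothesis.RiemannHypothesis.Theorems.UniversalFactorMediumLowWindowC
import Summits.RiemannHypothesis.RiemannHypothesis.Theorems.UniversalFactorMediumHighWin1
import Summits.RiemannHypothesis.RiemannHypothesis.Theorems.UniversalFactorMediumHighWin2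

/-!
# RiemannHypothesis / UniversalFactor — the crux `MediumKernelNoGo` (stmt-RiemannHypothesis-2577)

Route `RiemannHypothesis/UniversalFactor`; line `one-sided-average-sign-test` of the crux chain (lead's
skeleton v2, `Cruxes/MediumKernelNoGo/Lines/one_sided_average_sign_test.lean`, all seven registered
stubs landed).

**Statement.** For every `a ∈ [π/8, 32]` the cosine transform of the Laplace(`a`)-smoothed de Bruijn
kernel `Φ(u)/(1 + u²/a²)` — i.e. `F_a = H_0 ⋆ (a/2)e^{−a|·|}` — has a non-real zero
(`¬ HasOnlyRealZeros`).

**Proof (one-sided average sign test).** `(a² − D²)F_a = a²H_0` splits `F_a(x + iy)`, to second order in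
`y`, into the two one-sided averages `P_a(x) = ∫₀^∞ H_0(x − y)e^{−ay}dy`, `Q_a(x) = ∫₀^∞ H_0(x + y)e^{−ay}dy`;
a FILLED DIP `H_0(x) < 0 < P_a(x), Q_a(x)` (or a filled hump) at one real `x ≥ 0` contradicts the
Laguerre inequalities of a real entire function of order `< 2` with only real zeros
(`UniversalFactor.not_hasOnlyRealZeros_of_dip_certificate` / `_of_hump_certificate`,
`UniversalFactorLaguerreCriterion.lean`).  The certificates, per `a`-box with interval weights
`e^{−ay} ∈ [e^{−a₂y}, e^{−a₁y}]`:
* LOW window `a ∈ [π/8, 3/2]` (`stub_lowWindow`): hump certificates at `x = 64.6` (`a ≤ 0.445757`),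
  `x = 222.8` (`a ≤ 0.706253`) and `x = 223.2` (`a ≤ 3/2`), `H_0` at the `y`-nodes by certified
  Gauss–Legendre quadrature of `∫₀^∞ Φ(u) cos(xu) du` (files `UniversalFactorMedium{Defs,BoxDefs,UCells,
  UTables,UEval,YCells,YSums,Cover,LowDefs,LowWindowA/B/C}.lean`; one `native_decide` per window);
* HIGH window `a ∈ [3/2, 32]` (`stub_highWindow`): the dip certificate at Lehmer's point
  `x₀ = 2t₀ = 14010.16`, `H_0(2t) = −K₀ · Re[core(½+it)] · μ(t)` from certified `ζ(½+it)` and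
  second-order Stirling (the stmt-2582 engine `UniversalFactorLehmer*.lean`; files
  `UniversalFactorMediumHigh{Defs,Sums,Err,Cover,H0neg,Cell,Tails,SideP,SideQ,Win1,Win2}.lean`;
  one `native_decide` per window, boxes `[1.5,2,2.5,3.1,4]` and `[4,6,10,16,22,27,32]`).
This file only assembles: no `sorry`, no `native_decide` here (the five compiled certificates live in
the `…LowWindowA/B/C` and `…HighWin1/2` files, landed `--computational`).
-/

set_option linter.dupNamespace false

noncomputable section

open Complex MeasureTheory Set
open Literature.NumberTheory.LFunctions

namespace Summit.RiemannHypothesis.RiemannHypothesis.Theorems.UniversalFactor.OneSidedAverageSignTest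

open Summit.RiemannHypothesis.RiemannHypothesis.Theorems

/-- **Stub 6 · `stub_lowWindow`** (registered signature): for every `a ∈ [π/8, 3/2]` a point `x ≥ 0`
with a filled dip or a filled hump of the one-sided Laplace(`a`) averages of `H_0` — windows A, B, C of
the compiled u-side certificate (`π/8 > 0.392698` by `Real.pi_gt_d6`). -/
theorem stub_lowWindow :
    ∀ a : ℝ, Real.pi / 8 ≤ a → a ≤ 3 / 2 → ∃ x : ℝ, 0 ≤ x ∧
    (((deBruijnH 0 x).re < 0 ∧
      0 < (∫ y in Ioi (0:ℝ), deBruijnH 0 ((x : ℂ) - y) * (Real.exp (-(a * y)) : ℂ)).re ∧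
      0 < (∫ y in Ioi (0:ℝ), deBruijnH 0 ((x : ℂ) + y) * (Real.exp (-(a * y)) : ℂ)).re) ∨
     (0 < (deBruijnH 0 x).re ∧
      (∫ y in Ioi (0:ℝ), deBruijnH 0 ((x : ℂ) - y) * (Real.exp (-(a * y)) : ℂ)).re < 0 ∧
      (∫ y in Ioi (0:ℝ), deBruijnH 0 ((x : ℂ) + y) * (Real.exp (-(a * y)) : ℂ)).re < 0)) := by
  intro a h1 h2
  have hpi : (392698 : ℝ) / 1000000 ≤ a := by
    have := Real.pi_gt_d6
    linarith
  by_cases hA : a ≤ (445757 : ℝ) / 1000000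
  · exact UniversalFactor.stub_lowWindowA a hpi hA
  by_cases hB : a ≤ (706253 : ℝ) / 1000000
  · exact UniversalFactor.stub_lowWindowB a (by linarith) hB
  · exact UniversalFactor.stub_lowWindowC a (by linarith) (by linarith)

/-- **Stub 7 · `stub_highWindow`** (registered signature): for every `a ∈ [3/2, 32]` the filled dip
`H_0(x₀) < 0 < P_a(x₀), Q_a(x₀)` at Lehmer's point `x₀ = 2t₀ = 14010.16` — windows 1 (`a ≤ 4`) and 2
(`a ≥ 4`) of the compiled t-side certificate. -/
theorem stub_highWindow :
    ∀ a : ℝ, 3 / 2 ≤ a → a ≤ 32 → ∃ x : ℝ, 0 ≤ x ∧ (deBruijnH 0 x).re < 0 ∧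
    0 < (∫ y in Ioi (0:ℝ), deBruijnH 0 ((x : ℂ) - y) * (Real.exp (-(a * y)) : ℂ)).re ∧
    0 < (∫ y in Ioi (0:ℝ), deBruijnH 0 ((x : ℂ) + y) * (Real.exp (-(a * y)) : ℂ)).re := by
  intro a h1 h2
  refine ⟨2 * UniversalFactor.lehmerT0,
    by unfold UniversalFactor.lehmerT0 UniversalFactor.lehmerT0N UniversalFactor.lehmerT0D; norm_num, ?_⟩
  by_cases h4 : a ≤ 4
  · exact UniversalFactor.stub_highWindow1 a h1 h4
  · exact UniversalFactor.stub_highWindow2 a (not_le.1 h4).le h2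

/-- `π/8 < 3/2` (so the low window is a genuine interval and `0 < a` on the crux's range). -/
theorem pi_div_eight_lt : Real.pi / 8 < 3 / 2 := by
  have h := Real.pi_le_four
  linarith

/-- **The crux `UniversalFactor.MediumKernelNoGo`** (item stmt-RiemannHypothesis-2577, conjunct C4m of
the route's no-go block): for every `a ∈ [π/8, 32]`,
`¬ HasOnlyRealZeros (z ↦ ∫₀^∞ Φ(u)/(1 + u²/a²) cos(zu) du)`.  Given `a`: if `a ≤ 3/2` the low window
gives a point `x ≥ 0` with a filled dip or hump of the one-sided averages, else the high window gives a
filled dip at `x₀ = 14010.16`; the certificate theorems turn either into a non-real zero of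
`F_a = deBruijnHDiv (1 + u²/a²)`, which is the crux's inline integral definitionally. -/
theorem MediumKernelNoGo_proof :
    Summit.RiemannHypothesis.RiemannHypothesis.Theses.UniversalFactor.MediumKernelNoGo := by
  intro a ha h32
  have hπ := pi_div_eight_lt
  have ha0 : 0 < a := lt_of_lt_of_le (by positivity) ha
  by_cases h1 : a ≤ 3 / 2
  · -- the low window `π/8 ≤ a ≤ 3/2`
    obtain ⟨x, hx0, hcert⟩ := stub_lowWindow a ha h1
    rcases hcert with ⟨hHx, hP, hQ⟩ | ⟨hHx, hP, hQ⟩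
    · exact UniversalFactor.not_hasOnlyRealZeros_of_dip_certificate ha0 hx0 hHx hP hQ
    · exact UniversalFactor.not_hasOnlyRealZeros_of_hump_certificate ha0 hx0 hHx hP hQ
  · -- the high window `3/2 < a ≤ 32`
    push Not at h1
    obtain ⟨x, hx0, hHx, hP, hQ⟩ := stub_highWindow a h1.le h32
    exact UniversalFactor.not_hasOnlyRealZeros_of_dip_certificate ha0 hx0 hHx hP hQ

end Summit.RiemannHypothesis.RiemannHypothesis.Theorems.UniversalFactor.OneSidedAverageSignTest

end
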